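import Literature.Topology.FourManifolds.MTorusCoordinates
import HarnessLib

/-!
# The old piece of a circle surgery as a chart: `X ∖ c ↪ X^σ`

Infrastructure for the explicit fishtail neighbourhood (R. Gompf, *More Cappell–Shaneson spheres
are standard*, Algebr. Geom. Topol. 10 (2010), proof of Thm 2.1 and Lemma 2.2; the named fact
`Literature.Topology.FourManifolds.gompf2010_framedTwist`). The surgered manifold `X^σ` of a
circle surgery (`CircleNbhd.Surgered`, `CircleSurgeryExistence.lean`) is glued from the open
piece `X ∖ c(𝕊¹)` (a subtype of `X`) and `D̊² × 𝕊²`. Maps into `X` avoiding the circle are read in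
`X^σ` through

* `Literature.Topology.FourManifolds.toSurg ν : X → ν.Surgered` — `inl ⟨x, _⟩` on the complement
  of the circle (junk elsewhere); `toSurg_eq_inl`;
* `Literature.Topology.FourManifolds.complementChart ν` — the identity `X ⇀ ↥(X ∖ c)` as a partial
  diffeomorphism, hence `isLocalDiffeomorphAt_toSurg` at every point off the circle, and
  injectivity of `toSurg` on the complement (`toSurg_inj`).

Everything is proved; no named facts.

## References

* R. E. Gompf and A. I. Stipsicz, *4-manifolds and Kirby calculus*, GSM 20, AMS (1999), §5.2. [GompfStipsicz1999]
-/

noncomputable section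

open scoped ContDiff Topology Manifold Classical
open Set Function Filter

namespace Literature.Topology.FourManifolds

universe u

local notation "𝔼 " n:arg => EuclideanSpace ℝ (Fin n)
local notation "𝕊 " n:arg => (Metric.sphere (0 : EuclideanSpace ℝ (Fin (n + 1))) 1)

section ToSurg

variable {X : Type u} [TopologicalSpace X] [T2Space X] [ChartedSpace (𝔼 4) X]
  {γ : 𝕊 1 → X} (ν : CircleNbhd (𝓡 4) γ)

/-- **A point of `X` read in the surgered manifold** (`inl` on the complement of the circle,
junk `inl basePtA` on the circle). [folklore] -/
def toSurg (x : X) : ν.Surgered :=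
  if h : x ∈ ν.complement then ν.glueData.inl ⟨x, h⟩ else ν.glueData.inl ν.basePtA

variable {ν}

/-- Off the circle, `toSurg x = inl ⟨x, _⟩`. [folklore] -/
theorem toSurg_eq_inl {x : X} (h : x ∈ ν.complement) : toSurg ν x = ν.glueData.inl ⟨x, h⟩ := by
  rw [toSurg, dif_pos h]

/-- **`toSurg` is injective on the complement of the circle.** [folklore] -/
theorem toSurg_inj {x y : X} (hx : x ∈ ν.complement) (hy : y ∈ ν.complement) (h : toSurg ν x = toSurg ν y) : x = y := by
  rw [toSurg_eq_inl hx, toSurg_eq_inl hy] at h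
  exact congrArg Subtype.val (ν.glueData.inl_injective h)

variable (ν)

/-- **The identity `X ⇀ ↥(X ∖ c)` as a partial diffeomorphism** (source the complement). [folklore] -/
def complementChart : PartialDiffeomorph (𝓡 4) (𝓡 4) X ↥ν.complement ∞ where
  toFun x := if h : x ∈ ν.complement then ⟨x, h⟩ else ν.basePtA
  invFun a := (a : X)
  source := ν.complement
  target := univ
  map_source' _ _ := mem_univ _
  map_target' a _ := a.2
  left_inv' x hx := by
    have hx' : x ∈ ν.complement := hx
    simp only [dif_pos hx']
  right_inv' a _ := by
    have ha : (a : X) ∈ ν.complement := a.2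
    simp only [dif_pos ha]
  open_source := ν.complement.isOpen
  open_target := isOpen_univ
  contMDiffOn_toFun := by
    intro x hx
    refine ContMDiffAt.contMDiffWithinAt ?_
    rw [← ContMDiffAt.subtypeVal_comp_iff]
    have hev : (Subtype.val ∘ fun y : X ↦
        (if h : y ∈ ν.complement then (⟨y, h⟩ : ↥ν.complement) else ν.basePtA)) =ᶠ[𝓝 x] id := by
      filter_upwards [ν.complement.isOpen.mem_nhds hx] with y hy
      have hy' : y ∈ ν.complement := hy
      simp only [Function.comp_apply, dif_pos hy', id_eq]
    exact contMDiffAt_id.congr_of_eventuallyEq hev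
  contMDiffOn_invFun := contMDiff_subtype_val.contMDiffOn

variable {ν}

/-- The value of the chart on the complement. [folklore] -/
theorem complementChart_apply {x : X} (hx : x ∈ ν.complement) : complementChart ν x = ⟨x, hx⟩ := by
  show (if h : x ∈ ν.complement then (⟨x, h⟩ : ↥ν.complement) else ν.basePtA) = ⟨x, hx⟩
  rw [dif_pos hx]

variable [IsManifold (𝓡 4) ∞ X]

/-- **`toSurg` is a local diffeomorphism at every point off the circle.** [folklore] -/
theorem isLocalDiffeomorphAt_toSurg {x : X} (hx : x ∈ ν.complement) :
    IsLocalDiffeomorphAt (𝓡 4) 𝓘(ℝ, 𝔼 4) ∞ (toSurg ν) x := by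
  have h1 := PartialDiffeomorph.isLocalDiffeomorphAt (𝓡 4) (𝓡 4) ∞ (complementChart ν) (show x ∈ (complementChart ν).source from hx)
  have h2 := isLocalDiffeomorphAt_of_isSmoothEmbedding ν.glueData.isSmoothEmbedding_inl
    ν.glueData.isOpen_range_inl (complementChart ν x)
  have h := h1.comp (K := 𝓘(ℝ, 𝔼 4)) (P := ν.Surgered) h2
  refine isLocalDiffeomorphAt_congr_nhds' h ?_
  filter_upwards [ν.complement.isOpen.mem_nhds hx] with y hy
  show toSurg ν y = ν.glueData.inl (complementChart ν y)
  rw [toSurg_eq_inl hy, complementChart_apply hy]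

/-- **Smoothness of `toSurg` off the circle.** [folklore] -/
theorem contMDiffAt_toSurg {x : X} (hx : x ∈ ν.complement) : ContMDiffAt (𝓡 4) 𝓘(ℝ, 𝔼 4) ∞ (toSurg ν) x :=
  (isLocalDiffeomorphAt_toSurg hx).contMDiffAt

end ToSurg

end Literature.Topology.FourManifolds
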